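import Summits.CriticalPhenomena.Ising3DConformalLimit.Theorems.PerfectScreeningCoulombImpliesNontrivialOfUpperIsothermFrequently
import Summits.CriticalPhenomena.Ising3DConformalLimit.Theses.LeeYangGap
import Literature.Probability.LatticeModels.LeeYangLatticeLawRoots

/-!
# A non-vanishing block Binder cumulant gives a Lee–Yang zero at the fluctuation scale (line `SketchPub`, lead c3)

Crux `CoulombImpliesNontrivial` (route `PerfectScreening`, item stmt-CriticalPhenomena-13885). The line is complete
modulo its residual R (`stub_upperCriticalIsothermFrequently`), whose zero-field reading (lead c2,
`sketchPub_binderNonvanishing_of_upperIsothermFrequently`) is: under Coulomb, `g_L := (3Σ_L² − ⟨M_L⁴⟩)/Σ_L² ↛ 0`.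
Here: (A) two sharp one-sided fourth-order expansions (`two_log_mgfN_le_sharp` on the moment side, from the tree's
`NewmanLeeYang.mgfN_le_taylor`; `log_one_add_mul_sinh_sq_ge_sharp` on the product side); (B) the REVERSE of
Newman's coefficient inequality for a symmetric Lee–Yang lattice law, `3u₂² − Σp_k k⁴ ≤ 2m + 12Σbᵢ² − 8Σbᵢ`
(`newman_kappa_four_le`; with the tree's `LeeYangLatticeLaw.sum_mul_sq_eq_and_newman_ineq` this is Newman's
identity `−u₄ = 2m − 8Σbᵢ + 12Σbᵢ²`, Newman 1975 Thm 3); (C) the registered stub `stub_gapOfBinderNonvanishing`: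
`g_L ↛ 0 ⟹ LeeYangGap.NearCriticalLeeYangGap` (stmt-CriticalPhenomena-4945) at `β = β_c`, with the explicit zero
`θ₁ = arcsin(b_max^{-1/2})`, `θ₁²Σ_L ≤ 3π²/(2ε)` where `g_L ≥ ε` (reverse inequality ⟹ `εΣ_L² ≤ 6 b_max Σ_L`;
Jordan's inequality); and `nearCriticalLeeYangGap_of_upperIsothermFrequently`: under Coulomb, R ⟹ 4945, so the
line's residual sits ABOVE the existing open crux 4945, whose landed implication 4945 ⟹ crux
(`stub_cruxOfNearCriticalLeeYangGap`) closes r3. Reference: C. M. Newman, CMP 41 (1975) 1–9, Thms 3, 4, 7. -/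

noncomputable section

namespace Summit.CriticalPhenomena.Ising3DConformalLimit.PerfectScreeningCoulombImpliesNontrivial

open Literature.Probability.LatticeModels Literature.Barriers.CriticalPhenomena Filter Set Finset
open scoped Topology BigOperators

open NewmanLeeYang (sinhSqRem)

/-! ## Part A. Two sharp one-sided expansions -/

/-- `y² + y⁴/3 ≤ sinh² y` (`sinh² y = (cosh 2y − 1)/2` and `cosh u ≥ 1 + u²/2 + u⁴/24`). -/
theorem sq_add_pow_four_div_three_le_sinh_sq (y : ℝ) : y ^ 2 + y ^ 4 / 3 ≤ Real.sinh y ^ 2 := by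
  rw [NewmanLeeYang.sinh_sq_eq_cosh_two_mul]
  have h := NewmanLeeYang.cosh_taylor_four_le (2 * y)
  have e : (2 * y) ^ 2 = 4 * y ^ 2 ∧ (2 * y) ^ 4 = 16 * y ^ 4 := ⟨by ring, by ring⟩
  rw [e.1, e.2] at h
  linarith

/-- `(y² + y⁴/3 + C₀y⁶)² ≤ y⁴ + c₁ y⁶` for `|y| ≤ 1`, with `C₀ = NewmanLeeYang.sinhSqRem` and
`c₁ = (1/3 + C₀)(7/3 + C₀)`. -/
theorem sq_upper_sinh_sq_le {y : ℝ} (hy : |y| ≤ 1) :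
    (y ^ 2 + y ^ 4 / 3 + NewmanLeeYang.sinhSqRem * y ^ 6) ^ 2 ≤ y ^ 4 + ((1 / 3 + sinhSqRem) * (7 / 3 + sinhSqRem)) * y ^ 6 := by
  set C₀ := NewmanLeeYang.sinhSqRem with hC₀
  have hC₀0 : 0 ≤ C₀ := NewmanLeeYang.sinhSqRem_nonneg
  have hy2 : y ^ 2 ≤ 1 := by
    have := (sq_abs y).symm
    nlinarith [abs_nonneg y]
  have hy20 : 0 ≤ y ^ 2 := sq_nonneg y
  -- `a := y²/3 + C₀ y⁴ ≤ (1/3 + C₀) y²`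
  set a : ℝ := y ^ 2 / 3 + C₀ * y ^ 4 with ha
  have ha0 : 0 ≤ a := by positivity
  have hy4 : y ^ 4 ≤ y ^ 2 := by nlinarith
  have hale : a ≤ (1 / 3 + C₀) * y ^ 2 := by
    rw [ha]; nlinarith [mul_le_mul_of_nonneg_left hy4 hC₀0]
  have hale' : a ≤ 1 / 3 + C₀ := hale.trans (by nlinarith)
  -- `(1 + a)² ≤ 1 + (7/3 + C₀) a`
  have hsq : (1 + a) ^ 2 ≤ 1 + (7 / 3 + C₀) * a := by
    have : a ^ 2 ≤ (1 / 3 + C₀) * a := by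
      calc a ^ 2 = a * a := sq a
        _ ≤ (1 / 3 + C₀) * a := mul_le_mul_of_nonneg_right hale' ha0
    nlinarith
  have hexp : y ^ 2 + y ^ 4 / 3 + C₀ * y ^ 6 = y ^ 2 * (1 + a) := by rw [ha]; ring
  rw [hexp, mul_pow]
  calc (y ^ 2) ^ 2 * (1 + a) ^ 2 ≤ (y ^ 2) ^ 2 * (1 + (7 / 3 + C₀) * a) :=
        mul_le_mul_of_nonneg_left hsq (by positivity)
    _ ≤ (y ^ 2) ^ 2 * (1 + (7 / 3 + C₀) * ((1 / 3 + C₀) * y ^ 2)) := by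
        refine mul_le_mul_of_nonneg_left ?_ (by positivity)
        have h73 : 0 ≤ 7 / 3 + C₀ := by positivity
        nlinarith [mul_le_mul_of_nonneg_left hale h73]
    _ = y ^ 4 + ((1 / 3 + sinhSqRem) * (7 / 3 + sinhSqRem)) * y ^ 6 := by rw [← hC₀]; ring

/-- **Sharp local LOWER bound for one factor** (`|y| ≤ 1`, `b ≥ 0`): `b y² + (b/3 − b²/2) y⁴ − (b² c₁/2) y⁶
≤ log(1 + b sinh² y)` (exact `y⁴` coefficient; `log(1+w) ≥ w − w²/2`, `y² + y⁴/3 ≤ sinh² y ≤ y² + y⁴/3 + C₀y⁶`). -/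
theorem log_one_add_mul_sinh_sq_ge_sharp {b : ℝ} (hb : 0 ≤ b) {y : ℝ} (hy : |y| ≤ 1) :
    b * y ^ 2 + (b / 3 - b ^ 2 / 2) * y ^ 4 - b ^ 2 * ((1 / 3 + sinhSqRem) * (7 / 3 + sinhSqRem)) / 2 * y ^ 6 ≤
      Real.log (1 + b * Real.sinh y ^ 2) := by
  set σ : ℝ := Real.sinh y ^ 2 with hσ
  have hσ0 : 0 ≤ σ := sq_nonneg _
  have hlow : y ^ 2 + y ^ 4 / 3 ≤ σ := sq_add_pow_four_div_three_le_sinh_sq y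
  have hup : σ ≤ y ^ 2 + y ^ 4 / 3 + NewmanLeeYang.sinhSqRem * y ^ 6 := by
    have := NewmanLeeYang.sinh_sq_le y hy
    have e : NewmanLeeYang.sinhSqRem = 2 / 45 * Real.cosh 2 := rfl
    rw [hσ, e]; linarith
  have hυ0 : 0 ≤ y ^ 2 + y ^ 4 / 3 + NewmanLeeYang.sinhSqRem * y ^ 6 := hσ0.trans hup
  have hσ2 : σ ^ 2 ≤ y ^ 4 + ((1 / 3 + sinhSqRem) * (7 / 3 + sinhSqRem)) * y ^ 6 :=
    (pow_le_pow_left₀ hσ0 hup 2).trans (sq_upper_sinh_sq_le hy)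
  have hlog : b * σ - (b * σ) ^ 2 / 2 ≤ Real.log (1 + b * σ) :=
    NewmanLeeYang.sub_sq_div_two_le_log_one_add (by positivity)
  have h1 : b * (y ^ 2 + y ^ 4 / 3) ≤ b * σ := mul_le_mul_of_nonneg_left hlow hb
  have h2 : (b * σ) ^ 2 ≤ b ^ 2 * (y ^ 4 + ((1 / 3 + sinhSqRem) * (7 / 3 + sinhSqRem)) * y ^ 6) := by
    rw [mul_pow]
    exact mul_le_mul_of_nonneg_left hσ2 (sq_nonneg b)
  calc b * y ^ 2 + (b / 3 - b ^ 2 / 2) * y ^ 4 - b ^ 2 * ((1 / 3 + sinhSqRem) * (7 / 3 + sinhSqRem)) / 2 * y ^ 6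
      = b * (y ^ 2 + y ^ 4 / 3) - b ^ 2 * (y ^ 4 + ((1 / 3 + sinhSqRem) * (7 / 3 + sinhSqRem)) * y ^ 6) / 2 := by ring
    _ ≤ b * σ - (b * σ) ^ 2 / 2 := by linarith
    _ ≤ Real.log (1 + b * σ) := hlog

section MomentSide

variable {Ω : Type*} [Fintype Ω] {p : Ω → ℝ} {m : Ω → ℕ} {K : ℕ}

/-- **Sharp fourth-order UPPER expansion of `2 log M` on the moment side** (`|t| ≤ min(1, 1/(K+1))`):
`2 log M(t) ≤ u₂t² + ((m₄ − 3u₂²)/12) t⁴ + C_U t⁶`, `C_U = 2C₆ + (2/3)(u₂/2 + m₄/24 + C₆)³`, `C₆ = K⁶cosh 1/720`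
(`M ≤ 1 + x`, `x = u₂t²/2 + m₄t⁴/24 + C₆t⁶` by `NewmanLeeYang.mgfN_le_taylor`; `log(1+x) ≤ x − x²/2 + x³/3`). -/
theorem two_log_mgfN_le_sharp (hp : ∀ τ, 0 < p τ) (hp1 : ∑ τ, p τ = 1) (hmK : ∀ τ, m τ ≤ K) (ψ : Ω ≃ Ω)
    (hψp : ∀ τ, p (ψ τ) = p τ) (hψm : ∀ τ, m (ψ τ) + m τ = K) (τ₀ : Ω) {t : ℝ} (ht : |t| ≤ 1 / (K + 1))
    (ht1 : |t| ≤ 1) :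
    2 * Real.log (NewmanLeeYang.mgfN p m K t) ≤
      (∑ τ, p τ * NewmanLeeYang.spinSum m K τ ^ 2) * t ^ 2 +
        ((∑ τ, p τ * NewmanLeeYang.spinSum m K τ ^ 4) - 3 * (∑ τ, p τ * NewmanLeeYang.spinSum m K τ ^ 2) ^ 2) / 12
          * t ^ 4 +
        (2 * ((K : ℝ) ^ 6 * Real.cosh 1 / 720) +
          2 / 3 * ((∑ τ, p τ * NewmanLeeYang.spinSum m K τ ^ 2) / 2 +
            (∑ τ, p τ * NewmanLeeYang.spinSum m K τ ^ 4) / 24 + (K : ℝ) ^ 6 * Real.cosh 1 / 720) ^ 3) * t ^ 6 := by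
  set u₂ : ℝ := ∑ τ, p τ * NewmanLeeYang.spinSum m K τ ^ 2 with hu₂
  set m₄ : ℝ := ∑ τ, p τ * NewmanLeeYang.spinSum m K τ ^ 4 with hm₄
  set C₆ : ℝ := (K : ℝ) ^ 6 * Real.cosh 1 / 720 with hC₆
  have hu₂0 : 0 ≤ u₂ := Finset.sum_nonneg fun τ _ => mul_nonneg (hp τ).le (sq_nonneg _)
  have hm₄0 : 0 ≤ m₄ := Finset.sum_nonneg fun τ _ => mul_nonneg (hp τ).le (by positivity)
  have hC₆0 : 0 ≤ C₆ := by positivity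
  have hM := NewmanLeeYang.mgfN_le_taylor hp hp1 hmK ψ hψp hψm ht
  set x : ℝ := u₂ * t ^ 2 / 2 + m₄ * t ^ 4 / 24 + C₆ * t ^ 6 with hx
  have hMx : NewmanLeeYang.mgfN p m K t ≤ 1 + x := by
    change NewmanLeeYang.mgfN p m K t ≤ 1 + u₂ * t ^ 2 / 2 + m₄ * t ^ 4 / 24 + C₆ * t ^ 6 at hM
    rw [hx]; linarith
  have hx0 : 0 ≤ x := by positivity
  have hMpos : 0 < NewmanLeeYang.mgfN p m K t := NewmanLeeYang.mgfN_pos (m := m) (K := K) hp τ₀ t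
  have hlog1 := (Real.log_le_log hMpos hMx).trans (Literature.NumberTheory.Sieve.Chen.log_one_add_le_cubic hx0)
  have hxlow : u₂ * t ^ 2 / 2 ≤ x := by rw [hx]; nlinarith [sq_nonneg (t ^ 2), sq_nonneg (t ^ 3)]
  have hx2 : (u₂ * t ^ 2 / 2) ^ 2 ≤ x ^ 2 := pow_le_pow_left₀ (by positivity) hxlow 2
  have ht2 : t ^ 2 ≤ 1 := by
    have h := abs_le.1 ht1
    nlinarith
  have ht20 : 0 ≤ t ^ 2 := sq_nonneg t
  have ht4 : t ^ 4 ≤ t ^ 2 := by nlinarith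
  have ht6 : t ^ 6 ≤ t ^ 2 := by nlinarith
  set A : ℝ := u₂ / 2 + m₄ / 24 + C₆ with hA
  have hxA : x ≤ A * t ^ 2 := by
    rw [hx, hA]
    nlinarith [mul_le_mul_of_nonneg_left ht4 hm₄0, mul_le_mul_of_nonneg_left ht6 hC₆0]
  have hx3 : x ^ 3 ≤ A ^ 3 * t ^ 6 := by
    calc x ^ 3 ≤ (A * t ^ 2) ^ 3 := pow_le_pow_left₀ hx0 hxA 3
      _ = A ^ 3 * t ^ 6 := by ring
  have e2x : 2 * x = u₂ * t ^ 2 + m₄ / 12 * t ^ 4 + 2 * C₆ * t ^ 6 := by rw [hx]; ring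
  have esq : (u₂ * t ^ 2 / 2) ^ 2 = u₂ ^ 2 / 4 * t ^ 4 := by ring
  have key : 2 * (x - x ^ 2 / 2 + x ^ 3 / 3) ≤
      u₂ * t ^ 2 + (m₄ - 3 * u₂ ^ 2) / 12 * t ^ 4 + (2 * C₆ + 2 / 3 * A ^ 3) * t ^ 6 := by
    have e : 2 * (x - x ^ 2 / 2 + x ^ 3 / 3) = 2 * x - x ^ 2 + 2 / 3 * x ^ 3 := by ring
    rw [e]
    rw [esq] at hx2
    linarith
  linarith

end MomentSide

/-! ## Part B. The reverse of Newman's coefficient inequality -/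

/-- **Reverse Newman inequality** for a symmetric lattice law `p` on `[-K,K] ∩ (K + 2ℤ)` of mass `1` with
Laplace transform `cosh^m t ∏ᵢ (1 + bᵢ sinh² t)` (`bᵢ ≥ 1`): `3u₂² − Σ p_k k⁴ ≤ 2m + 12Σbᵢ² − 8Σbᵢ`; with the
tree's `LeeYangLatticeLaw.sum_mul_sq_eq_and_newman_ineq` this is Newman's identity (Newman 1975, Thm 3). -/
theorem newman_kappa_four_le (K : ℕ) (p : ℤ → ℝ) (h0 : ∀ k, 0 ≤ p k)
    (hsymm : ∀ k, p (-k) = p k) (hpar : ∀ k : ℤ, ¬ (2 ∣ (k + K)) → p k = 0)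
    (hsum : ∑ k ∈ Icc (-(K : ℤ)) K, p k = 1) {m n : ℕ} {b : Fin n → ℝ} (hb : ∀ i, 1 ≤ b i)
    (h : ∀ t : ℝ, ∑ k ∈ Icc (-(K : ℤ)) K, p k * Real.exp (t * k) =
      Real.cosh t ^ m * ∏ i, (1 + b i * Real.sinh t ^ 2)) :
    3 * (∑ k ∈ Icc (-(K : ℤ)) K, p k * (k : ℝ) ^ 2) ^ 2 - ∑ k ∈ Icc (-(K : ℤ)) K, p k * (k : ℝ) ^ 4 ≤
      2 * (m : ℝ) + 12 * ∑ i, b i ^ 2 - 8 * ∑ i, b i := by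
  classical
  obtain ⟨hS₁u, -⟩ := LeeYangLatticeLaw.sum_mul_sq_eq_and_newman_ineq K p h0 hsymm hpar hsum hb h
  obtain ⟨S, K', m', ψ, τ₁, -, hp, hmK, hψp, hψm, -, hspin, htr⟩ :=
    LeeYangLatticeLaw.exists_frame K p h0 hsymm hpar hsum
  set q : ↥S → ℝ := fun τ => p τ with hq
  have hq1 : ∑ τ, q τ = 1 := by rw [hq, ← hsum]; exact htr p fun k hk => hk
  have hb0 : ∀ i, 0 ≤ b i := fun i => zero_le_one.trans (hb i)
  have hpos : ∀ (s : ℝ) (i : Fin n), 0 < 1 + b i * Real.sinh s ^ 2 := fun s i => by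
    have := hb0 i; positivity
  have hMq : ∀ t, NewmanLeeYang.mgfN q m' K' t = ∑ k ∈ Icc (-(K : ℤ)) K, p k * Real.exp (t * k) := by
    intro t
    rw [NewmanLeeYang.mgfN, ← htr (fun k => p k * Real.exp (t * k)) (fun k hk => by simp [hk])]
    exact Fintype.sum_congr _ _ fun τ => by rw [hspin τ]
  have hmom : ∀ j : ℕ, ∑ τ, q τ * NewmanLeeYang.spinSum m' K' τ ^ j =
      ∑ k ∈ Icc (-(K : ℤ)) K, p k * (k : ℝ) ^ j := by
    intro j
    rw [← htr (fun k => p k * (k : ℝ) ^ j) (fun k hk => by simp [hk])]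
    exact Fintype.sum_congr _ _ fun τ => by rw [hspin τ]
  set u₂ : ℝ := ∑ k ∈ Icc (-(K : ℤ)) K, p k * (k : ℝ) ^ 2 with hu₂
  set m₄ : ℝ := ∑ k ∈ Icc (-(K : ℤ)) K, p k * (k : ℝ) ^ 4 with hm₄
  -- moment side on `(0, ε)`: the SHARP upper bound
  set ε : ℝ := min 1 (1 / (K' + 1)) with hε
  have hε0 : 0 < ε := lt_min one_pos (by positivity)
  have hεle : ∀ s : ℝ, 0 < s → s < ε → |s| ≤ 1 ∧ |s| ≤ 1 / (K' + 1) := fun s hs0 hsε => by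
    rw [abs_of_pos hs0]
    exact ⟨(hsε.trans_le (min_le_left _ _)).le, (hsε.trans_le (min_le_right _ _)).le⟩
  set C₆ : ℝ := (K' : ℝ) ^ 6 * Real.cosh 1 / 720 with hC₆
  set CU : ℝ := 2 * C₆ + 2 / 3 * (u₂ / 2 + m₄ / 24 + C₆) ^ 3 with hCU
  have hE : ∀ s : ℝ, 0 < s → s < ε →
      2 * Real.log (∑ k ∈ Icc (-(K : ℤ)) K, p k * Real.exp (s * k)) ≤
        u₂ * s ^ 2 + (m₄ - 3 * u₂ ^ 2) / 12 * s ^ 4 + CU * s ^ 6 := fun s hs0 hsε => by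
    have := two_log_mgfN_le_sharp hp hq1 hmK ψ hψp hψm τ₁ (hεle s hs0 hsε).2 (hεle s hs0 hsε).1
    rwa [hMq, hmom 2, hmom 4] at this
  -- product side: the SHARP lower bound
  have hP : ∀ s, 2 * Real.log (∑ k ∈ Icc (-(K : ℤ)) K, p k * Real.exp (s * k)) =
      (m : ℝ) * Real.log (1 + 1 * Real.sinh s ^ 2) + 2 * ∑ i, Real.log (1 + b i * Real.sinh s ^ 2) := by
    intro s
    have hc : Real.log (1 + 1 * Real.sinh s ^ 2) = 2 * Real.log (Real.cosh s) := by
      rw [one_mul, ← Real.cosh_sq', Real.log_pow]; norm_num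
    rw [h s, Real.log_mul (pow_ne_zero _ (Real.cosh_pos s).ne') (Finset.prod_pos fun i _ => hpos s i).ne',
      Real.log_pow, Real.log_prod fun i _ => (hpos s i).ne', hc]
    ring
  set S₁ : ℝ := (m : ℝ) + 2 * ∑ i, b i with hS₁
  set S₂ : ℝ := (m : ℝ) + 2 * ∑ i, b i ^ 2 with hS₂
  set CP : ℝ := (m : ℝ) * (((1 / 3 + sinhSqRem) * (7 / 3 + sinhSqRem)) / 2) +
    2 * ∑ i, b i ^ 2 * ((1 / 3 + sinhSqRem) * (7 / 3 + sinhSqRem)) / 2 with hCP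
  have hPlow : ∀ s : ℝ, |s| ≤ 1 →
      S₁ * s ^ 2 + (S₁ / 3 - S₂ / 2) * s ^ 4 - CP * s ^ 6 ≤
        2 * Real.log (∑ k ∈ Icc (-(K : ℤ)) K, p k * Real.exp (s * k)) := by
    intro s hs
    rw [hP s]
    have h1 := mul_le_mul_of_nonneg_left (log_one_add_mul_sinh_sq_ge_sharp zero_le_one hs) (Nat.cast_nonneg m)
    have h2 := Finset.sum_le_sum fun i (_ : i ∈ Finset.univ) => log_one_add_mul_sinh_sq_ge_sharp (hb0 i) hs
    have h3 : ∑ i, (b i * s ^ 2 + (b i / 3 - b i ^ 2 / 2) * s ^ 4 -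
        b i ^ 2 * ((1 / 3 + sinhSqRem) * (7 / 3 + sinhSqRem)) / 2 * s ^ 6) =
        (∑ i, b i) * s ^ 2 + ((∑ i, b i) / 3 - (∑ i, b i ^ 2) / 2) * s ^ 4 -
          (∑ i, b i ^ 2 * ((1 / 3 + sinhSqRem) * (7 / 3 + sinhSqRem)) / 2) * s ^ 6 := by
      rw [Finset.sum_sub_distrib, Finset.sum_add_distrib, ← Finset.sum_mul, ← Finset.sum_mul, ← Finset.sum_mul,
        Finset.sum_sub_distrib, ← Finset.sum_div, ← Finset.sum_div]
    rw [h3] at h2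
    rw [hS₁, hS₂, hCP]
    nlinarith [h1, h2]
  -- comparison of the two expansions: `β := S₁/3 - S₂/2 - (m₄ - 3u₂²)/12 ≤ 0`
  have hB := NewmanLeeYang.coeff_nonpos_of_expansion_le (α := S₁ - u₂)
    (β := (S₁ / 3 - S₂ / 2) - (m₄ - 3 * u₂ ^ 2) / 12) (γ := CP + CU) hε0
    fun s hs0 hsε => by
      have h1 := hE s hs0 hsε
      have h2 := hPlow s (hεle s hs0 hsε).1
      nlinarith
  have hβ := hB.2 (by rw [hS₁]; linarith [hS₁u])
  rw [hS₁, hS₂] at hβ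
  rw [hu₂] at hβ hS₁u
  rw [hm₄] at hβ
  nlinarith [hβ, hS₁u]


/-! ## Part C. From a non-vanishing block Binder cumulant to a Lee–Yang zero at the fluctuation scale -/

/-- The Lee–Yang package of the critical block `M_L` (S1a + S1b), with BOTH directions of Newman's
fourth-cumulant bound: `2m + 12Σbᵢ² − 8Σbᵢ ≤ 3Σ_L² − ⟨M_L⁴⟩ ≤ 2m + 12Σbᵢ² − 8Σbᵢ`. -/
theorem blockPackage_reverse (L : ℕ) :
    ∃ (m n : ℕ) (b : Fin n → ℝ), (∀ i, 1 ≤ b i) ∧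
      (∀ θ : ℝ, plusExpect 3 (criticalBeta 3) 0 (fun σ => Real.cos (θ * ∑ x ∈ box 3 L, spinAt x σ)) =
        Real.cos θ ^ m * ∏ i, (1 - b i * Real.sin θ ^ 2)) ∧
      ((m : ℝ) + 2 * ∑ i, b i = plusExpect 3 (criticalBeta 3) 0 (fun σ => (∑ x ∈ box 3 L, spinAt x σ) ^ 2)) ∧
      (3 * (plusExpect 3 (criticalBeta 3) 0 (fun σ => (∑ x ∈ box 3 L, spinAt x σ) ^ 2)) ^ 2 -
          plusExpect 3 (criticalBeta 3) 0 (fun σ => (∑ x ∈ box 3 L, spinAt x σ) ^ 4) ≤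
        2 * (m : ℝ) + 12 * ∑ i, b i ^ 2 - 8 * ∑ i, b i) ∧
      (2 * (m : ℝ) + 12 * ∑ i, b i ^ 2 - 8 * ∑ i, b i ≤
        3 * (plusExpect 3 (criticalBeta 3) 0 (fun σ => (∑ x ∈ box 3 L, spinAt x σ) ^ 2)) ^ 2 -
          plusExpect 3 (criticalBeta 3) 0 (fun σ => (∑ x ∈ box 3 L, spinAt x σ) ^ 4)) := by
  obtain ⟨p, h0, hsymm, hpar, hsum, hf, hLY⟩ := stub_blockLaw L
  obtain ⟨m, n, b, hb, -, hcos, hexp, -, hu2, hineq, -⟩ := stub_leeYangPackage _ p h0 hsymm hpar hsum hLY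
  have hrev := newman_kappa_four_le _ p h0 hsymm hpar hsum hb hexp
  have hV : plusExpect 3 (criticalBeta 3) 0 (fun σ => (∑ x ∈ box 3 L, spinAt x σ) ^ 2) =
      ∑ k ∈ Finset.Icc (-(((2 * L + 1) ^ 3 : ℕ) : ℤ)) ((2 * L + 1) ^ 3 : ℕ), p k * (k : ℝ) ^ 2 :=
    hf (fun r => r ^ 2)
  have hM4 : plusExpect 3 (criticalBeta 3) 0 (fun σ => (∑ x ∈ box 3 L, spinAt x σ) ^ 4) =
      ∑ k ∈ Finset.Icc (-(((2 * L + 1) ^ 3 : ℕ) : ℤ)) ((2 * L + 1) ^ 3 : ℕ), p k * (k : ℝ) ^ 4 :=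
    hf (fun r => r ^ 4)
  refine ⟨m, n, b, hb, fun θ => ?_, ?_, ?_, ?_⟩
  · rw [← hcos θ]
    exact hf (fun r => Real.cos (θ * r))
  · rw [hV]; exact hu2
  · rw [hV, hM4]; exact hrev
  · rw [hV, hM4]; exact hineq

/-- **B ⟹ GAP** (registered stub of line `SketchPub`, skeleton v11): if the critical block Binder cumulant
`g_L = (3Σ_L² − ⟨M_L⁴⟩)/Σ_L²` does NOT tend to zero, then `LeeYangGap.NearCriticalLeeYangGap` (stmt-4945) holds, at
`β = β_c`, with the zero `θ₁ = arcsin(b_max^{-1/2})`, `θ₁²Σ_L ≤ 3π²/(2ε)` along the sequence where `g_L ≥ ε`. -/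
theorem stub_gapOfBinderNonvanishing :
    (¬ Tendsto (fun L : ℕ =>
        (3 * (plusExpect 3 (criticalBeta 3) 0 (fun σ => (∑ x ∈ box 3 L, spinAt x σ) ^ 2)) ^ 2 -
            plusExpect 3 (criticalBeta 3) 0 (fun σ => (∑ x ∈ box 3 L, spinAt x σ) ^ 4)) /
          (plusExpect 3 (criticalBeta 3) 0 (fun σ => (∑ x ∈ box 3 L, spinAt x σ) ^ 2)) ^ 2)
        atTop (𝓝 0)) →
    Summit.CriticalPhenomena.Ising3DConformalLimit.Theses.LeeYangGap.NearCriticalLeeYangGap := by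
  intro hnot
  set V : ℕ → ℝ := fun L => plusExpect 3 (criticalBeta 3) 0 (fun σ => (∑ x ∈ box 3 L, spinAt x σ) ^ 2) with hVdef
  set M4 : ℕ → ℝ := fun L => plusExpect 3 (criticalBeta 3) 0 (fun σ => (∑ x ∈ box 3 L, spinAt x σ) ^ 4) with hM4def
  set g : ℕ → ℝ := fun L => (3 * V L ^ 2 - M4 L) / V L ^ 2 with hgdef
  change ¬ Tendsto g atTop (𝓝 0) at hnot
  have hg0 : ∀ L, 0 ≤ g L := by
    intro L
    obtain ⟨m, n, b, hb, -, -, -, hineq⟩ := blockPackage_reverse L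
    have h1 : 0 ≤ 2 * (m : ℝ) + 12 * ∑ i, b i ^ 2 - 8 * ∑ i, b i := by
      have : 8 * ∑ i, b i ≤ 12 * ∑ i, b i ^ 2 := by
        rw [Finset.mul_sum, Finset.mul_sum]
        exact Finset.sum_le_sum fun i _ => by nlinarith [hb i]
      have hm : 0 ≤ (m : ℝ) := Nat.cast_nonneg m
      linarith
    have hineq' : 2 * (m : ℝ) + 12 * ∑ i, b i ^ 2 - 8 * ∑ i, b i ≤ 3 * V L ^ 2 - M4 L := hineq
    exact div_nonneg (h1.trans hineq') (sq_nonneg _)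
  obtain ⟨ε, hε, hfreq⟩ : ∃ ε : ℝ, 0 < ε ∧ ∃ᶠ L in atTop, ε ≤ g L := by
    by_contra hcon
    refine hnot (tendsto_order.2 ⟨fun a ha => Eventually.of_forall fun L => ha.trans_le (hg0 L), fun a ha => ?_⟩)
    by_contra hev
    exact hcon ⟨a, ha, (Filter.not_eventually.1 hev).mono fun L hL => not_lt.1 hL⟩
  refine ⟨3 * Real.pi ^ 2 / (2 * ε), hfreq.mono fun L hL => ?_⟩
  obtain ⟨m, n, b, hb, hcos, hVeq0, hrev0, -⟩ := blockPackage_reverse L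
  have hVeq : (m : ℝ) + 2 * ∑ i, b i = V L := hVeq0
  have hrev : 3 * V L ^ 2 - M4 L ≤ 2 * (m : ℝ) + 12 * ∑ i, b i ^ 2 - 8 * ∑ i, b i := hrev0
  clear hVeq0 hrev0
  have hVpos : 0 < V L := sketchPub_blockVariance_pos L
  have hK : ε * V L ^ 2 ≤ 3 * V L ^ 2 - M4 L := (le_div_iff₀ (pow_pos hVpos 2)).1 hL
  have hπ := Real.pi_pos
  rcases Nat.eq_zero_or_pos n with hn | hn
  · -- no mode: `V = m`, `εm² ≤ 2m`, zero at `θ = π/2`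
    subst hn
    simp only [Finset.univ_eq_empty, Finset.sum_empty, mul_zero, add_zero, sub_zero] at hVeq hrev
    have hm : (m : ℝ) = V L := hVeq
    have hmpos : 0 < (m : ℝ) := hm ▸ hVpos
    have hm0 : m ≠ 0 := by rintro rfl; simp at hmpos
    have hmle : ε * (m : ℝ) ≤ 2 := by
      have : ε * (m : ℝ) ^ 2 ≤ 2 * m := by
        have h2 := hK.trans hrev
        rwa [← hm] at h2
      have h' : ε * (m : ℝ) * m ≤ 2 * m := by nlinarith
      exact le_of_mul_le_mul_right h' hmpos
    refine ⟨criticalBeta 3, Real.pi / 2, criticalBeta_nonneg 3, le_rfl, by positivity, ?_, ?_⟩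
    · change (Real.pi / 2) ^ 2 * V L ≤ 3 * Real.pi ^ 2 / (2 * ε)
      rw [← hm, div_eq_mul_inv (3 * Real.pi ^ 2), show (Real.pi / 2) ^ 2 * (m : ℝ) =
        Real.pi ^ 2 * (m / 4) by ring]
      rw [show 3 * Real.pi ^ 2 * (2 * ε)⁻¹ = Real.pi ^ 2 * (3 / (2 * ε)) by ring]
      refine mul_le_mul_of_nonneg_left ?_ (sq_nonneg _)
      rw [div_le_div_iff₀ (by norm_num) (by positivity)]
      nlinarith
    · rw [hcos (Real.pi / 2), Real.cos_pi_div_two, zero_pow hm0, zero_mul]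
  · -- at least one mode: `b_max ≥ εΣ_L/6`, zero at `θ₁ = arcsin(b_max^{-1/2})`
    haveI : Nonempty (Fin n) := ⟨⟨0, hn⟩⟩
    obtain ⟨i₀, -, hi₀⟩ := Finset.exists_max_image Finset.univ b Finset.univ_nonempty
    set B : ℝ := b i₀ with hBdef
    have hB1 : 1 ≤ B := hb i₀
    have hB0 : 0 < B := one_pos.trans_le hB1
    have hbi : ∀ i, b i ≤ B := fun i => hi₀ i (Finset.mem_univ i)
    have hsumsq : ∑ i, b i ^ 2 ≤ B * ∑ i, b i := by
      rw [Finset.mul_sum]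
      exact Finset.sum_le_sum fun i _ => by nlinarith [hb i, hbi i]
    have hsum0 : 0 ≤ ∑ i, b i := Finset.sum_nonneg fun i _ => zero_le_one.trans (hb i)
    have h6 : 3 * V L ^ 2 - M4 L ≤ 6 * B * V L := by
      rw [← hVeq]
      nlinarith [mul_nonneg (Nat.cast_nonneg m) hB0.le]
    have hεV : ε * V L ≤ 6 * B := by
      have : ε * V L ^ 2 ≤ 6 * B * V L := hK.trans h6
      nlinarith
    set s : ℝ := (Real.sqrt B)⁻¹ with hsdef
    have hsB : Real.sqrt B ≠ 0 := (Real.sqrt_pos.2 hB0).ne'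
    have hs0 : 0 < s := inv_pos.2 (Real.sqrt_pos.2 hB0)
    have hs1 : s ≤ 1 := inv_le_one_of_one_le₀ (Real.one_le_sqrt.2 hB1)
    have hs2 : s ^ 2 = B⁻¹ := by rw [hsdef, inv_pow, Real.sq_sqrt hB0.le]
    set θ : ℝ := Real.arcsin s with hθdef
    have hθpos : 0 < θ := Real.arcsin_pos.2 hs0
    have hθle : θ ≤ Real.pi / 2 := Real.arcsin_le_pi_div_two s
    have hsin : Real.sin θ = s := Real.sin_arcsin (by linarith) hs1
    have hjordan : 2 / Real.pi * θ ≤ Real.sin θ := Real.mul_le_sin hθpos.le hθle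
    have hθs : θ ≤ Real.pi / 2 * s := by
      rw [hsin] at hjordan
      have := mul_le_mul_of_nonneg_left hjordan (show 0 ≤ Real.pi / 2 by positivity)
      calc θ = Real.pi / 2 * (2 / Real.pi * θ) := by field_simp
        _ ≤ Real.pi / 2 * s := this
    have hθsq : θ ^ 2 ≤ Real.pi ^ 2 / 4 * B⁻¹ := by
      calc θ ^ 2 ≤ (Real.pi / 2 * s) ^ 2 := pow_le_pow_left₀ hθpos.le hθs 2
        _ = Real.pi ^ 2 / 4 * s ^ 2 := by ring
        _ = Real.pi ^ 2 / 4 * B⁻¹ := by rw [hs2]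
    refine ⟨criticalBeta 3, θ, criticalBeta_nonneg 3, le_rfl, hθpos, ?_, ?_⟩
    · change θ ^ 2 * V L ≤ 3 * Real.pi ^ 2 / (2 * ε)
      have hVB : V L * B⁻¹ ≤ 6 / ε := by
        rw [← div_eq_mul_inv, div_le_div_iff₀ hB0 hε]
        linarith
      calc θ ^ 2 * V L ≤ Real.pi ^ 2 / 4 * B⁻¹ * V L := mul_le_mul_of_nonneg_right hθsq hVpos.le
        _ = Real.pi ^ 2 / 4 * (V L * B⁻¹) := by ring
        _ ≤ Real.pi ^ 2 / 4 * (6 / ε) := mul_le_mul_of_nonneg_left hVB (by positivity)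
        _ = 3 * Real.pi ^ 2 / (2 * ε) := by field_simp; ring
    · rw [hcos θ]
      have hfac : 1 - b i₀ * Real.sin θ ^ 2 = 0 := by
        rw [hsin, hs2, ← hBdef, mul_inv_cancel₀ hB0.ne', sub_self]
      rw [Finset.prod_eq_zero (Finset.mem_univ i₀) hfac, mul_zero]

/-- **Under Coulomb, the residual R implies crux 4945**: the Coulomb law and the upper critical isotherm along
one sequence of fields (the line's residual `stub_upperCriticalIsothermFrequently`) give
`LeeYangGap.NearCriticalLeeYangGap` (stmt-4945) — S4, the zero-field reading of R (`g_L ↛ 0`), and B ⟹ GAP. -/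
theorem nearCriticalLeeYangGap_of_upperIsothermFrequently
    (hC : ∃ c : ℝ, 0 < c ∧ ∀ x : Site 3, x ≠ 0 → c / ‖x‖ ≤ criticalTwoPoint 3 x)
    (hR : ∃ A : ℝ, ∃ᶠ h in 𝓝[>] (0:ℝ),
        magnetizationInField 3 (criticalBeta 3) h ≤ A * h ^ ((1:ℝ) / 5)) :
    Summit.CriticalPhenomena.Ising3DConformalLimit.Theses.LeeYangGap.NearCriticalLeeYangGap :=
  stub_gapOfBinderNonvanishing
    (sketchPub_binderNonvanishing_of_upperIsothermFrequently (stub_blockVariance hC) hR)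

end Summit.CriticalPhenomena.Ising3DConformalLimit.PerfectScreeningCoulombImpliesNontrivial
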